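import Literature.Barriers.PneNP.EdmondsPolytopeBipartiteCoverUpperBound
import Literature.Barriers.PneNP.ExtendedFormulationYannakakisConverse
import HarnessLib

/-!
# The slack matrix of Edmonds' matching polytope `P_M(K_n)`: Yannakakis' and the cone-factorization
# theorem for it, and its nonnegative- and psd-rank windows (FGPRT 2015 Thm. 3.3; Rothvoß 2017 Thm. 4)

Companion of `PerfectMatchingPsdLiftLowerBounds.lean` (which does this for the PERFECT matching
polytope `P_PM(K_n)` and Edmonds' odd-cut / full slack matrices `pmOddCutSlack`, `pmFullSlack`) for
Edmonds' matching polytope `P_M(K_n)` = the tree's `StephenTuncel1999.edmondsPolytope ⊤` with its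
inequality system `edmondsLHS a · x ≤ edmondsRHS a`, `a ∈ E ⊕ V ⊕ {S : |S| odd}` (nonnegativity, degree
and blossom rows; `MatchingPolytopeExtensionUpperBound.lean`) and its vertex set, the matching vectors
`matchingVectors ⊤` (Edmonds' Theorem (P), `edmondsPolytope_eq_convexHull`).

H. Fawzi, J. Gouveia, P. A. Parrilo, R. Z. Robinson, R. R. Thomas, *Positive semidefinite rank*,
Math. Program. 153 (2015) = arXiv:1407.4095 [FawziEtAl2015], Def. 3.1 (p09: "the slack matrix of `P`,
denoted `S_P`, is the `v × f` matrix with `(i,j)` entry `b_j − a_jᵀ x_i`") and **Theorem 3.3** (p09: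
"the size of the smallest psd lift of a polytope `P` is equal to the psd rank of the slack matrix
`S_P`"); T. Rothvoß, J. ACM 64 (2017) = arXiv:1311.2369 [Rothvoss2017], **Theorem 4** (PDF p. 5,
Yannakakis: "`xc(P) = rk₊(S)`") and §1 (PDF p. 4, L26–30); M. Yannakakis, JCSS 43 (1991)
[Yannakakis1991], Thm. 3 (p. 457).

## What is proved (no named facts)

* `edmondsSlack n` — the slack matrix `S(P_M(K_n))`, rows Edmonds' inequalities, columns the matching
  vectors: `S_{a,χ} = d_a − c_a · χ`; `edmondsSlack_nonneg`, `edmondsSlack_inl` (edge rows read `χ_e`).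
* **`hasNonnegFactorization_edmondsSlack_of_hasEFOfSize`** (`xc ≥ r ⇒ rk₊ ≤ r + 1`, the tree's
  `HasEFOfSize.exists_nonneg_factorization`) and **`hasEFOfSize_edmondsPolytope_top_of_hasNonnegFactorization`**
  (`rk₊ ≤ s ⇒ xc ≤ s`, the tree's `hasEFOfSize_of_complete_nonneg_factorization` with Edmonds' theorem
  as the completeness of the rows) — Yannakakis' theorem for `P_M(K_n)` in the tree's two currencies.
* **`hasPsdLift_edmondsPolytope_top_iff_hasPsdFactorization_edmondsSlack`** — FGPRT Theorem 3.3 for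
  `P_M(K_n)`: for `k ≥ 1`, a psd lift of size `k` exists iff `rk_psd(S(P_M(K_n))) ≤ k` (the tree's
  cone-factorization theorem `hasPsdPowerFactorization_slack_iff_hasBlockPsdLift`, one block);
  `one_le_of_hasPsdFactorization_edmondsSlack` / `one_le_of_hasPsdLift_edmondsPolytope_top` (size `0`
  occurs on neither side for `n ≥ 2`), `setOf_hasPsdLift_edmondsPolytope_top_eq` (the two size sets
  coincide), `hasEFOfSize_edmondsPolytope_top_iff_upToOne` (`xc` and `rk₊` agree up to one).
* Windows, from `EdmondsPolytopeBipartiteCoverUpperBound.lean` and the tree's lower bounds: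
  `hasNonnegFactorization_edmondsSlack_halfExp` / `hasPsdFactorization_edmondsSlack_halfExp`
  (`rk_psd ≤ rk₊ ≤ n⁴·2^{⌈n/2⌉} + 1`), `Rothvoss2017_thm1_edmondsSlack` (`rk₊(S(P_M(K_n))) ≥ 2^{cn}`
  eventually), `choose_two_sub_add_one_le_of_hasPsdFactorization_edmondsSlack`
  (`rk_psd(S(P_M(K_n))) ≥ C(m,2) − m + 1`, even `4 ≤ m ≤ n`).

Stature (cell pnp-psdrank line 1): instrument/catalogue — dictionary glue for the SECOND matching
polytope family; the cell's object (the odd-cut slack matrix of `P_PM(K_n)`) is untouched; no new lower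
bound is proved here (those quoted are the tree's); nothing on P versus NP.

## References

* [FawziEtAl2015] H. Fawzi, J. Gouveia, P. A. Parrilo, R. Z. Robinson, R. R. Thomas, Math. Program.
  153 (2015) 133–177; arXiv:1407.4095 — Def. 3.1, Thm. 3.3 (p09), Prop. 2.5 (p05).
* [Rothvoss2017] T. Rothvoß, J. ACM 64 (2017); arXiv:1311.2369 — Thm. 1, Thm. 4 (PDF p. 5), §1 (p. 4).
* [Yannakakis1991] M. Yannakakis, *Expressing combinatorial optimization problems by linear programs*,
  J. Comput. System Sci. 43 (1991) 441–466 — Thm. 3 (p. 457).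
* [GouveiaParriloThomas2013] J. Gouveia, P. Parrilo, R. Thomas, Math. Oper. Res. 38 (2013) — Thm. 2.4.
* [Edmonds1965] J. Edmonds, J. Res. Nat. Bur. Standards 69B (1965) — §2 Thm. (P) (p. 126).
-/

noncomputable section

open Finset Matrix

namespace Literature.Barriers.PneNP

open Literature.Combinatorics.Optimization Literature.Combinatorics.Optimization.StephenTuncel1999

variable {n k : ℕ}

/-! ### The slack matrix of `P_M(K_n)` -/

/-- The column index: the matching vectors of `K_n` (the vertices of `P_M(K_n)`, Edmonds' `P`).
[cite: Edmonds1965, §2 Thm. (P) (p. 126)] -/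
abbrev MatchVec (n : ℕ) : Type := ↥(matchingVectors (⊤ : SimpleGraph (Fin n)))

/-- **The slack matrix of Edmonds' matching polytope** `S(P_M(K_n))`: rows Edmonds' inequalities
`c_a · x ≤ d_a` (`a ∈ E ⊕ V ⊕ {S : |S| odd}`), columns the matching vectors `χ`, entry `d_a − c_a · χ`.
[cite: FawziEtAl2015, Def. 3.1 (p09)] [cite: Rothvoss2017, Thm. 4 (PDF p. 5)] -/
def edmondsSlack (n : ℕ) : EdmondsIndex (⊤ : SimpleGraph (Fin n)) → MatchVec n → ℝ :=
  fun a y => edmondsRHS (⊤ : SimpleGraph (Fin n)) a -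
    edmondsLHS (⊤ : SimpleGraph (Fin n)) a ⬝ᵥ (y : EKn n → ℝ)

/-- Unfolding. [cite: FawziEtAl2015, Def. 3.1 (p09)] -/
theorem edmondsSlack_apply (a : EdmondsIndex (⊤ : SimpleGraph (Fin n))) (y : MatchVec n) :
    edmondsSlack n a y = edmondsRHS (⊤ : SimpleGraph (Fin n)) a -
      edmondsLHS (⊤ : SimpleGraph (Fin n)) a ⬝ᵥ (y : EKn n → ℝ) := rfl

/-- Edmonds' inequalities are valid on the matching vectors: the slack matrix is entrywise nonnegative.
[cite: Edmonds1965, §2 (p. 126: "the points `P` are vertices of `C`")] -/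
theorem edmondsSlack_nonneg (a : EdmondsIndex (⊤ : SimpleGraph (Fin n))) (y : MatchVec n) :
    0 ≤ edmondsSlack n a y := by
  have hy : (y : EKn n → ℝ) ∈ edmondsPolytope (⊤ : SimpleGraph (Fin n)) :=
    matchingVectors_subset_edmondsPolytope y.2
  rw [edmondsPolytope_eq_setOf_dotProduct] at hy
  exact sub_nonneg.2 (hy a)

/-- The edge rows of the slack matrix read off the coordinates: `S_{e,χ} = 0 − (−χ_e) = χ_e`.
[cite: Edmonds1965, §2 (1) (p. 125)] -/
theorem edmondsSlack_inl (e : EKn n) (y : MatchVec n) :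
    edmondsSlack n (Sum.inl e) y = (y : EKn n → ℝ) e := by
  simp [edmondsSlack, edmondsLHS, edmondsRHS, neg_dotProduct, single_dotProduct]

/-- The matching vectors form a finite set (`0/1` vectors). [folklore] -/
private theorem matchingVectors_top_finite' : (matchingVectors (⊤ : SimpleGraph (Fin n))).Finite := by
  refine Set.Finite.subset (Set.finite_range fun f : EKn n → Bool =>
    fun e => if f e then (1 : ℝ) else 0) fun y hy => ?_
  refine ⟨fun e => decide (y e = 1), funext fun e => ?_⟩
  rcases hy.1 e with h | h
  · simp [h]
  · simp [h]

/-- `Set.range` of the column embedding is the set of matching vectors. [folklore] -/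
private theorem range_val_matchVec :
    Set.range (Subtype.val : MatchVec n → (EKn n → ℝ)) = matchingVectors (⊤ : SimpleGraph (Fin n)) :=
  Subtype.range_coe

/-- Edmonds' theorem in the "V = H" form the factorization theorems consume:
`conv(range of the columns) = {x | c_a · x ≤ d_a ∀ a}`. [cite: Edmonds1965, §2 Thm. (P) (p. 126)] -/
theorem convexHull_range_matchVec_eq_setOf (n : ℕ) :
    convexHull ℝ (Set.range (Subtype.val : MatchVec n → (EKn n → ℝ))) =
      {x | ∀ a, edmondsLHS (⊤ : SimpleGraph (Fin n)) a ⬝ᵥ x ≤ edmondsRHS (⊤ : SimpleGraph (Fin n)) a} := by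
  rw [range_val_matchVec, ← edmondsPolytope_eq_convexHull, edmondsPolytope_eq_setOf_dotProduct]

/-- `conv(range of the columns) = P_M(K_n)`. [cite: Edmonds1965, §2 Thm. (P) (p. 126)] -/
theorem convexHull_range_matchVec (n : ℕ) :
    convexHull ℝ (Set.range (Subtype.val : MatchVec n → (EKn n → ℝ))) =
      edmondsPolytope (⊤ : SimpleGraph (Fin n)) := by
  rw [range_val_matchVec, ← edmondsPolytope_eq_convexHull]

/-! ### Yannakakis' theorem for `P_M(K_n)` -/

/-- **`xc(P_M(K_n)) ≥ r ⇒ rk₊(S(P_M(K_n))) ≤ r + 1`** (Yannakakis, lower-bound direction; the tree's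
`HasEFOfSize.exists_nonneg_factorization` — LP multipliers plus one constant coordinate — fed the
matching vectors and Edmonds' rows). [cite: Rothvoss2017, Thm. 4 (PDF p. 5)] [cite: Yannakakis1991, Thm. 3 (p. 457)] -/
theorem hasNonnegFactorization_edmondsSlack_of_hasEFOfSize {r : ℕ}
    (h : HasEFOfSize (edmondsPolytope (⊤ : SimpleGraph (Fin n))) r) :
    HasNonnegFactorization (edmondsSlack n) (r + 1) := by
  classical
  obtain ⟨U, T, hU, hT, hfac⟩ := h.exists_nonneg_factorization
    (A := EdmondsIndex (⊤ : SimpleGraph (Fin n))) (B := MatchVec n)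
    (fun y => (y : EKn n → ℝ)) (fun y => matchingVectors_subset_edmondsPolytope y.2)
    (edmondsLHS (⊤ : SimpleGraph (Fin n))) (edmondsRHS (⊤ : SimpleGraph (Fin n)))
    (fun a x hx => by rw [edmondsPolytope_eq_setOf_dotProduct] at hx; exact hx a)
  refine ⟨fun a l => U a (finSuccEquiv r l), fun l y => T y (finSuccEquiv r l), fun a l => hU _ _,
    fun l y => hT _ _, fun a y => ?_⟩
  rw [edmondsSlack_apply, hfac a y]
  exact (Fintype.sum_equiv (finSuccEquiv r) (fun l => U a (finSuccEquiv r l) * T y (finSuccEquiv r l))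
    (fun i => U a i * T y i) fun _ => rfl).symm

/-- **`rk₊(S(P_M(K_n))) ≤ s ⇒ xc(P_M(K_n)) ≤ s`** (Yannakakis, converse direction, with Edmonds'
theorem as the completeness of the rows: the tree's `hasEFOfSize_of_complete_nonneg_factorization`).
[cite: Yannakakis1991, Thm. 3 (p. 457)] [cite: Rothvoss2017, Thm. 4 (PDF p. 5)] -/
theorem hasEFOfSize_edmondsPolytope_top_of_hasNonnegFactorization {s : ℕ}
    (h : HasNonnegFactorization (edmondsSlack n) s) :
    HasEFOfSize (edmondsPolytope (⊤ : SimpleGraph (Fin n))) s := by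
  classical
  obtain ⟨U, V, hU, hV, hfac⟩ := h
  have hcomplete : ∀ x : EKn n → ℝ,
      (∀ a, edmondsLHS (⊤ : SimpleGraph (Fin n)) a ⬝ᵥ x ≤ edmondsRHS (⊤ : SimpleGraph (Fin n)) a) →
        x ∈ convexHull ℝ (Set.range (Subtype.val : MatchVec n → (EKn n → ℝ))) := fun x hx => by
    rw [convexHull_range_matchVec_eq_setOf]
    exact hx
  have hEF := hasEFOfSize_of_complete_nonneg_factorization (σ := Fin s)
    (Subtype.val : MatchVec n → (EKn n → ℝ)) (edmondsLHS (⊤ : SimpleGraph (Fin n)))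
    (edmondsRHS (⊤ : SimpleGraph (Fin n))) hcomplete U (fun y l => V l y) hU (fun y l => hV l y)
    (fun a y => hfac a y)
  rwa [convexHull_range_matchVec, Fintype.card_fin] at hEF

/-! ### FGPRT Theorem 3.3 for `P_M(K_n)` -/

/-- **FGPRT Theorem 3.3 for Edmonds' matching polytope: `P_M(K_n)` has a psd lift of size `k ≥ 1` iff
its slack matrix has a psd factorization of size `k`** ("the size of the smallest psd lift of a polytope
`P` is equal to the psd rank of the slack matrix `S_P`"), by the tree's cone-factorization theorem for
polytopes `hasPsdPowerFactorization_slack_iff_hasBlockPsdLift` (one block) and Edmonds' theorem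
`conv(matchingVectors) = {x | c_a · x ≤ d_a}`.
[cite: FawziEtAl2015, Thm. 3.3 (p09)] [cite: GouveiaParriloThomas2013, Thm. 2.4 (§2)] [cite: Edmonds1965, §2 Thm. (P) (p. 126)] -/
theorem hasPsdLift_edmondsPolytope_top_iff_hasPsdFactorization_edmondsSlack (hk : 1 ≤ k) :
    HasPsdLift (edmondsPolytope (⊤ : SimpleGraph (Fin n))) k ↔
      HasPsdFactorization (edmondsSlack n) k := by
  classical
  haveI : Finite (MatchVec n) := matchingVectors_top_finite'.to_subtype
  have key := hasPsdPowerFactorization_slack_iff_hasBlockPsdLift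
    (x := (Subtype.val : MatchVec n → (EKn n → ℝ))) (a := edmondsLHS (⊤ : SimpleGraph (Fin n)))
    (b := edmondsRHS (⊤ : SimpleGraph (Fin n))) hk le_rfl (convexHull_range_matchVec_eq_setOf n)
  rw [convexHull_range_matchVec, hasBlockPsdLift_one_iff, FixedSizePsdRank.hasPsdPowerFactorization_one_iff] at key
  rw [← key]
  exact hasPsdFactorization_transpose_iff (M := edmondsSlack n)

/-- A single edge is a matching: `e_e` is a matching vector. [cite: Edmonds1965, §2 (p. 126)] -/
theorem single_mem_matchingVectors (e : EKn n) :
    (Pi.single e (1 : ℝ) : EKn n → ℝ) ∈ matchingVectors (⊤ : SimpleGraph (Fin n)) := by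
  classical
  refine ⟨fun e' => ?_, fun v => ?_⟩
  · by_cases h : e' = e
    · right; rw [h, Pi.single_eq_same]
    · left; rw [Pi.single_eq_of_ne h]
  · calc ∑ e' ∈ univ.filter (fun e' : EKn n => v ∈ (e' : Sym2 (Fin n))), (Pi.single e (1 : ℝ) : EKn n → ℝ) e'
        ≤ ∑ e', (Pi.single e (1 : ℝ) : EKn n → ℝ) e' :=
          Finset.sum_le_univ_sum_of_nonneg fun e' => by
            by_cases h : e' = e
            · rw [h, Pi.single_eq_same]; norm_num
            · rw [Pi.single_eq_of_ne h]
      _ = 1 := Fintype.sum_pi_single' e 1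

/-- **Size `0` does not occur** (`n ≥ 2`): the edge row of the single-edge matching `{0,1}` has the
entry `1`, so no psd factorization of `S(P_M(K_n))` has size `0`. [cite: FawziEtAl2015, Def. 2.2 (p05)] -/
theorem one_le_of_hasPsdFactorization_edmondsSlack (h2 : 2 ≤ n)
    (h : HasPsdFactorization (edmondsSlack n) k) : 1 ≤ k := by
  by_contra hk
  have hk0 : k = 0 := by omega
  subst hk0
  have hadj : (⊤ : SimpleGraph (Fin n)).Adj ⟨0, by omega⟩ ⟨1, by omega⟩ := by
    rw [SimpleGraph.top_adj]
    exact fun h => by simpa using congrArg Fin.val h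
  set e : EKn n := ⟨s(⟨0, by omega⟩, ⟨1, by omega⟩), (SimpleGraph.mem_edgeSet _).2 hadj⟩
  have hzero := (hasPsdFactorization_zero_iff.1 h) (Sum.inl e)
    ⟨Pi.single e 1, single_mem_matchingVectors e⟩
  rw [edmondsSlack_inl] at hzero
  simp at hzero

/-- A psd lift of `P_M(K_n)` (`n ≥ 2`) has size `k ≥ 1`: a size-`0` lift `π(S^0_+ ∩ L)` lies in `{0}`,
but the single-edge matching vector `e_{01}` is a nonzero point of `P_M(K_n)`.
[cite: FawziEtAl2015, §3.1 eq. (3) (p09)] -/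
theorem one_le_of_hasPsdLift_edmondsPolytope_top (h2 : 2 ≤ n)
    (h : HasPsdLift (edmondsPolytope (⊤ : SimpleGraph (Fin n))) k) : 1 ≤ k := by
  classical
  by_contra hk
  have hk0 : k = 0 := by omega
  subst hk0
  obtain ⟨L, π, hC⟩ := h
  have hsub : edmondsPolytope (⊤ : SimpleGraph (Fin n)) ⊆ {0} := by
    rw [hC]
    rintro _ ⟨M, -, rfl⟩
    have hM : M = 0 := Matrix.ext fun i _ => Fin.elim0 i
    rw [hM, map_zero]
    rfl
  have hadj : (⊤ : SimpleGraph (Fin n)).Adj ⟨0, by omega⟩ ⟨1, by omega⟩ := by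
    rw [SimpleGraph.top_adj]
    exact fun h => by simpa using congrArg Fin.val h
  set e : EKn n := ⟨s(⟨0, by omega⟩, ⟨1, by omega⟩), (SimpleGraph.mem_edgeSet _).2 hadj⟩
  have hmem := hsub (matchingVectors_subset_edmondsPolytope (single_mem_matchingVectors e))
  rw [Set.mem_singleton_iff] at hmem
  have h1 := congrFun hmem e
  simp at h1

/-- Hence, for `n ≥ 2`, **the psd lift sizes of `P_M(K_n)` are exactly the psd factorization sizes of
its slack matrix** (size `0` occurs in neither). [cite: FawziEtAl2015, Thm. 3.3 (p09)] -/
theorem setOf_hasPsdLift_edmondsPolytope_top_eq (h2 : 2 ≤ n) :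
    {k : ℕ | HasPsdLift (edmondsPolytope (⊤ : SimpleGraph (Fin n))) k} =
      {k : ℕ | HasPsdFactorization (edmondsSlack n) k} := by
  ext k
  simp only [Set.mem_setOf_eq]
  rcases Nat.eq_zero_or_pos k with rfl | hk
  · exact ⟨fun h => absurd (one_le_of_hasPsdLift_edmondsPolytope_top h2 h) (by omega),
      fun h => absurd (one_le_of_hasPsdFactorization_edmondsSlack h2 h) (by omega)⟩
  · exact hasPsdLift_edmondsPolytope_top_iff_hasPsdFactorization_edmondsSlack hk

/-- Likewise **`xc(P_M(K_n))` and `rk₊(S(P_M(K_n)))` determine each other up to one**: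
`rk₊ ≤ xc + 1` and `xc ≤ rk₊`. [cite: Rothvoss2017, Thm. 4 (PDF p. 5)] [cite: Yannakakis1991, Thm. 3 (p. 457)] -/
theorem hasEFOfSize_edmondsPolytope_top_iff_upToOne (r : ℕ) :
    (HasEFOfSize (edmondsPolytope (⊤ : SimpleGraph (Fin n))) r →
        HasNonnegFactorization (edmondsSlack n) (r + 1)) ∧
      (HasNonnegFactorization (edmondsSlack n) r →
        HasEFOfSize (edmondsPolytope (⊤ : SimpleGraph (Fin n))) r) :=
  ⟨hasNonnegFactorization_edmondsSlack_of_hasEFOfSize,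
    hasEFOfSize_edmondsPolytope_top_of_hasNonnegFactorization⟩

/-! ### The windows for `S(P_M(K_n))` -/

/-- **`rk₊(S(P_M(K_n))) ≤ n⁴ · 2^{⌈n/2⌉} + 1`** (`n ≥ 4`): Yannakakis applied to the bipartite-cover
extended formulation `hasEFOfSize_edmondsPolytope_top_halfExp`. [cite: Rothvoss2017, Thm. 4 (PDF p. 5) and §1 (PDF p. 4, L26–30)] -/
theorem hasNonnegFactorization_edmondsSlack_halfExp (hn : 4 ≤ n) :
    HasNonnegFactorization (edmondsSlack n) (n ^ 4 * 2 ^ ((n + 1) / 2) + 1) :=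
  hasNonnegFactorization_edmondsSlack_of_hasEFOfSize (hasEFOfSize_edmondsPolytope_top_halfExp hn)

/-- **`rk_psd(S(P_M(K_n))) ≤ n⁴ · 2^{⌈n/2⌉} + 1`** (`n ≥ 4`; diagonal factors, `rk_psd ≤ rk₊`).
[cite: FawziEtAl2015, Prop. 2.5 (p05)] [cite: Rothvoss2017, §1 (PDF p. 4, L26–30)] -/
theorem hasPsdFactorization_edmondsSlack_halfExp (hn : 4 ≤ n) :
    HasPsdFactorization (edmondsSlack n) (n ^ 4 * 2 ^ ((n + 1) / 2) + 1) := by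
  obtain ⟨U, V, hU, hV, hS⟩ := hasNonnegFactorization_edmondsSlack_halfExp hn
  exact HasPsdFactorization.of_nonnegFactorization U V hU hV hS

/-- **`rk₊(S(P_M(K_n))) ≥ 2^{cn}` eventually** — Rothvoß's Theorem 1 for all matchings (tree:
`Rothvoss2017_thm1_matchingPolytope_all`) in the slack currency, through the converse Yannakakis
direction `hasEFOfSize_edmondsPolytope_top_of_hasNonnegFactorization`.
[cite: Rothvoss2017, Thm. 1 (PDF p. 4) and Thm. 4 (PDF p. 5)] -/
theorem Rothvoss2017_thm1_edmondsSlack :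
    ∃ c : ℝ, 0 < c ∧ ∀ᶠ n : ℕ in Filter.atTop, ∀ s : ℕ,
      HasNonnegFactorization (edmondsSlack n) s → (2 : ℝ) ^ (c * n) ≤ s := by
  obtain ⟨c, hc, hev⟩ := Rothvoss2017_thm1_matchingPolytope_all
  refine ⟨c, hc, hev.mono fun n hn s hs => ?_⟩
  exact hn s (hasEFOfSize_edmondsPolytope_top_of_hasNonnegFactorization hs)

/-- **`rk_psd(S(P_M(K_n))) ≥ C(m,2) − m + 1`** for every even `4 ≤ m ≤ n`: FGPRT Theorem 3.3 turns a
factorization into a psd lift of `P_M(K_n)`, which restricts to `P_PM(K_m)` (tree: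
`choose_two_sub_add_one_le_of_hasPsdLift_edmondsPolytope`). [cite: FawziEtAl2015, Thm. 3.3 (p09)] [cite: Rothvoss2017, §1 (PDF p. 4, L40)] -/
theorem choose_two_sub_add_one_le_of_hasPsdFactorization_edmondsSlack {m : ℕ} (hm : Even m)
    (h4 : 4 ≤ m) (hmn : m ≤ n) (h : HasPsdFactorization (edmondsSlack n) k) :
    m.choose 2 - m + 1 ≤ k := by
  have hk : 1 ≤ k := one_le_of_hasPsdFactorization_edmondsSlack (by omega) h
  exact choose_two_sub_add_one_le_of_hasPsdLift_edmondsPolytope hm h4 hmn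
    ((hasPsdLift_edmondsPolytope_top_iff_hasPsdFactorization_edmondsSlack hk).2 h)

/-- **The psd-rank window of the slack matrix of `P_M(K_n)`**: `rk_psd(S(P_M(K_n))) ∈
[C(m,2) − m + 1, n⁴·2^{⌈n/2⌉} + 1]` for every even `4 ≤ m ≤ n`. [cite: FawziEtAl2015, Thm. 3.3 (p09)] [cite: Rothvoss2017, §1 (PDF p. 4)] -/
theorem edmondsSlack_psdRank_window {m : ℕ} (hn : 4 ≤ n) (hm : Even m) (h4 : 4 ≤ m) (hmn : m ≤ n) :
    (∀ k : ℕ, HasPsdFactorization (edmondsSlack n) k → m.choose 2 - m + 1 ≤ k) ∧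
      HasPsdFactorization (edmondsSlack n) (n ^ 4 * 2 ^ ((n + 1) / 2) + 1) :=
  ⟨fun _ hk => choose_two_sub_add_one_le_of_hasPsdFactorization_edmondsSlack hm h4 hmn hk,
    hasPsdFactorization_edmondsSlack_halfExp hn⟩

/-- **The nonnegative-rank window of the slack matrix of `P_M(K_n)`**: `2^{cn} ≤ rk₊(S(P_M(K_n)))`
eventually, and `rk₊(S(P_M(K_n))) ≤ n⁴·2^{⌈n/2⌉} + 1` for `n ≥ 4` — i.e. `rk₊ = 2^{Θ(n)}` with the
exponent window `[cn, ⌈n/2⌉ + 4 log₂ n + o(1)]`. [cite: Rothvoss2017, Thm. 1 (PDF p. 4), Thm. 4 (PDF p. 5), §1 (PDF p. 4, L26–30)] -/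
theorem edmondsSlack_nonnegRank_window :
    (∃ c : ℝ, 0 < c ∧ ∀ᶠ n : ℕ in Filter.atTop, ∀ s : ℕ,
      HasNonnegFactorization (edmondsSlack n) s → (2 : ℝ) ^ (c * n) ≤ s) ∧
    ∀ n : ℕ, 4 ≤ n → HasNonnegFactorization (edmondsSlack n) (n ^ 4 * 2 ^ ((n + 1) / 2) + 1) :=
  ⟨Rothvoss2017_thm1_edmondsSlack, fun _ hn => hasNonnegFactorization_edmondsSlack_halfExp hn⟩

end Literature.Barriers.PneNP

end
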